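import Mathlib.Algebra.Order.BigOperators.Group.Finset
import Mathlib.Data.Fintype.Pi
import Literature.Combinatorics.SetFamily.BiasedMeasure
import HarnessLib

/-!
# Product measure on Boolean vectors (toolkit for Rossman 2010, Theorem 1)

Elementary finite-sum probability on the Boolean vectors `x : ι → Bool` over a finite index type
`ι` (for Rossman's theorem: `ι` = the potential edges of `Kₙ`, `x` = a graph), each coordinate
being `true` independently with probability `p`:

* `onSet x` — the support `{i | x i}` of `x` (a `Finset ι`); `x ↦ onSet x` is the order
  isomorphism with `Finset ι` (inverse of `Literature.Combinatorics.SetFamily.finsetEquivFun`);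
* `pw p x = p^{|onSet x|} (1-p)^{|ι| - |onSet x|}` — the weight of `x`
  (`= biasedWeight p (onSet x)` of `BiasedMeasure.lean`);
* `prob p P = ∑_{x : P x} pw p x` — the probability of an event `P` (a `Prop`-valued predicate,
  classical decidability inside; `prob_eq` rewrites it with any instance);
* the usual rules: `prob_mono`, `prob_true`, `prob_not`, `prob_or_le`, `prob_exists_le`
  (union bound), the marginals `prob_forall_eq_true = p^{|S|}`, `prob_apply_eq_false = 1 - p`,
  and the bridge `prob_comp_onSet` to sums of `biasedWeight` over `Finset ι` (the form of the
  spread lemma, `SpreadLemmaProofs.lean`).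

This is the probability space `G(n,p)` of Rossman 2010, §2 written without measure theory, as in
`RossmanMonotoneClique.lean` (`gnpProb`; the identification is `gnpProb_filter_eq_prob` in
`RossmanMonotoneCliqueGraphs.lean`).

## References

* B. Rossman, *The monotone complexity of k-clique on random graphs*, FOCS 2010 / SIAM J.
  Comput. 43 (2014), §2 [Rossman2010].
* S. Janson, T. Łuczak, A. Ruciński, *Random Graphs* (2000), §1.1 [folklore].
-/

noncomputable section

namespace Literature.Computability.Complexity

open Finset Literature.Combinatorics.SetFamily

variable {ι : Type*} [Fintype ι] [DecidableEq ι]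

/-! ### Supports of Boolean vectors -/

/-- The support `{i | x i = true}` of a Boolean vector (for a graph given by its edge
indicators: its edge set). [folklore] -/
def onSet (x : ι → Bool) : Finset ι := univ.filter fun i => x i = true

omit [DecidableEq ι] in
/-- Membership in the support. [folklore] -/
@[simp] theorem mem_onSet (x : ι → Bool) (i : ι) : i ∈ onSet x ↔ x i = true := by
  simp [onSet]

/-- `onSet` is the inverse of `finsetEquivFun` (definitional). [folklore] -/
theorem onSet_eq_finsetEquivFun_symm (x : ι → Bool) : onSet x = finsetEquivFun.symm x := rfl

omit [DecidableEq ι] in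
/-- The order on Boolean vectors is inclusion of supports. [folklore] -/
theorem le_iff_onSet_subset (x y : ι → Bool) : x ≤ y ↔ onSet x ⊆ onSet y := by
  simp only [Pi.le_def, Bool.le_iff_imp, Finset.subset_iff, mem_onSet]

omit [DecidableEq ι] in
/-- `onSet` is injective. [folklore] -/
theorem onSet_injective : Function.Injective (onSet : (ι → Bool) → Finset ι) := by
  intro x y h
  funext i
  have := congrArg (i ∈ ·) h
  simp only [mem_onSet, eq_iff_iff] at this
  rcases hx : x i with _ | _ <;> rcases hy : y i with _ | _ <;> simp_all

omit [DecidableEq ι] in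
/-- Two vectors with the same support are equal. [folklore] -/
theorem onSet_inj {x y : ι → Bool} : onSet x = onSet y ↔ x = y := onSet_injective.eq_iff

/-- The support of a union is the union of the supports. [folklore] -/
@[simp] theorem onSet_sup (x y : ι → Bool) : onSet (x ⊔ y) = onSet x ∪ onSet y := by
  ext i
  simp only [mem_onSet, Finset.mem_union, Pi.sup_apply]
  change (x i || y i) = true ↔ _
  rw [Bool.or_eq_true]

/-- The support of an intersection is the intersection of the supports. [folklore] -/
@[simp] theorem onSet_inf (x y : ι → Bool) : onSet (x ⊓ y) = onSet x ∩ onSet y := by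
  ext i
  simp only [mem_onSet, Finset.mem_inter, Pi.inf_apply]
  change (x i && y i) = true ↔ _
  rw [Bool.and_eq_true]

/-- The indicator vector of a finite set. [folklore] -/
def indVec (S : Finset ι) : ι → Bool := fun i => decide (i ∈ S)

/-- The indicator vector of `S` has support `S`. [folklore] -/
@[simp] theorem onSet_indVec (S : Finset ι) : onSet (indVec S) = S := by
  ext i; simp [indVec]

/-- Every vector is the indicator of its support. [folklore] -/
@[simp] theorem indVec_onSet (x : ι → Bool) : indVec (onSet x) = x := by
  funext i
  rcases h : x i with _ | _ <;> simp [indVec, h]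

/-- `indVec S ≤ x ↔ S ⊆ onSet x`. [folklore] -/
theorem indVec_le_iff (S : Finset ι) (x : ι → Bool) : indVec S ≤ x ↔ S ⊆ onSet x := by
  rw [le_iff_onSet_subset, onSet_indVec]

omit [DecidableEq ι] in
/-- The support of the empty vector. [folklore] -/
@[simp] theorem onSet_bot : onSet (⊥ : ι → Bool) = ∅ := by
  ext i; simp [mem_onSet]

/-- Strictly below a vector one can switch off one more `true` coordinate: if `y < x` there is a
coordinate `i` on in `x`, off in `y`, with `y ≤ x` off `i`. [folklore] -/
theorem exists_le_update_false_of_lt {x y : ι → Bool} (h : y < x) :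
    ∃ i, x i = true ∧ y i = false ∧ y ≤ Function.update x i false := by
  classical
  obtain ⟨hle, hne⟩ := lt_iff_le_and_ne.1 h
  have : ∃ i, y i ≠ x i := by
    by_contra hc
    push Not at hc
    exact hne (funext hc)
  obtain ⟨i, hi⟩ := this
  have hyx := hle i
  rw [Bool.le_iff_imp] at hyx
  rcases hy : y i with _ | _
  · rcases hx : x i with _ | _
    · exact absurd (hy.trans hx.symm) hi
    · refine ⟨i, hx, hy, fun j => ?_⟩
      by_cases hj : j = i
      · subst hj; simp [hy]
      · rw [Function.update_of_ne hj]; exact hle j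
  · rw [hy] at hyx hi; exact absurd (hyx rfl).symm hi

/-! ### Weights and probabilities -/

/-- The `p`-biased weight `p^{|onSet x|} (1-p)^{|ι| - |onSet x|}` of a Boolean vector: each
coordinate is `true` independently with probability `p` (the `G(n,p)` weight of a graph,
Rossman 2010, §2). [cite: Rossman2010, §2 (p. 3)] -/
def pw (p : ℝ) (x : ι → Bool) : ℝ := biasedWeight p (onSet x)

omit [DecidableEq ι] in
/-- Unfolding `pw`. [folklore] -/
theorem pw_eq (p : ℝ) (x : ι → Bool) :
    pw p x = p ^ #(onSet x) * (1 - p) ^ (Fintype.card ι - #(onSet x)) := rfl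

omit [DecidableEq ι] in
/-- Weights are nonnegative for `p ∈ [0,1]`. [folklore] -/
theorem pw_nonneg {p : ℝ} (hp0 : 0 ≤ p) (hp1 : p ≤ 1) (x : ι → Bool) : 0 ≤ pw p x :=
  biasedWeight_nonneg hp0 hp1 _

open Classical in
/-- `Pr[P]` for the `p`-biased random Boolean vector: the total weight of the vectors satisfying
`P` (Rossman 2010, §2, `G(n,p)`). [cite: Rossman2010, §2 (p. 3)] -/
def prob (p : ℝ) (P : (ι → Bool) → Prop) : ℝ := ∑ x ∈ univ.filter P, pw p x

/-- `prob` with an arbitrary decidability instance. [folklore] -/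
theorem prob_eq (p : ℝ) (P : (ι → Bool) → Prop) [DecidablePred P] :
    prob p P = ∑ x ∈ univ.filter P, pw p x := by
  unfold prob
  congr 1
  exact filter_congr_decidable _ _ _

/-- `prob` as a sum of indicator-weighted terms. [folklore] -/
theorem prob_eq_sum_ite (p : ℝ) (P : (ι → Bool) → Prop) [DecidablePred P] :
    prob p P = ∑ x, if P x then pw p x else 0 := by
  rw [prob_eq, sum_filter]

/-- Events with the same extension have the same probability. [folklore] -/
theorem prob_congr {p : ℝ} {P Q : (ι → Bool) → Prop} (h : ∀ x, P x ↔ Q x) : prob p P = prob p Q := by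
  classical
  rw [prob_eq, prob_eq, filter_congr fun x _ => h x]

/-- Probabilities are nonnegative (`p ∈ [0,1]`). [folklore] -/
theorem prob_nonneg {p : ℝ} (hp0 : 0 ≤ p) (hp1 : p ≤ 1) (P : (ι → Bool) → Prop) : 0 ≤ prob p P := by
  classical
  rw [prob_eq]
  exact sum_nonneg fun x _ => pw_nonneg hp0 hp1 x

/-- Monotonicity: `P ⊆ Q ⇒ Pr[P] ≤ Pr[Q]` (`p ∈ [0,1]`). [folklore] -/
theorem prob_mono {p : ℝ} (hp0 : 0 ≤ p) (hp1 : p ≤ 1) {P Q : (ι → Bool) → Prop}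
    (h : ∀ x, P x → Q x) : prob p P ≤ prob p Q := by
  classical
  rw [prob_eq, prob_eq]
  exact sum_le_sum_of_subset_of_nonneg (fun x hx => by
    simp only [mem_filter, mem_univ, true_and] at hx ⊢; exact h x hx) fun x _ _ => pw_nonneg hp0 hp1 x

/-- Bridge to `BiasedMeasure.lean`: the probability of an event depending only on the support is
the `biasedWeight`-sum over the corresponding family of sets. [folklore] -/
theorem prob_comp_onSet (p : ℝ) (Q : Finset ι → Prop) [DecidablePred Q] :
    prob p (fun x => Q (onSet x)) = ∑ W ∈ univ.filter Q, biasedWeight p W := by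
  classical
  rw [prob_eq, sum_filter, sum_filter, sum_finset_eq_sum_fun]
  rfl

/-- Converse bridge: a `biasedWeight`-sum over a family of sets is the probability of the
corresponding support event. [folklore] -/
theorem sum_biasedWeight_filter_eq_prob (p : ℝ) (Q : Finset ι → Prop) [DecidablePred Q] :
    ∑ W ∈ univ.filter Q, biasedWeight p W = prob p (fun x => Q (onSet x)) :=
  (prob_comp_onSet p Q).symm

/-- Total mass one: `Pr[True] = 1` (no hypothesis on `p`). [folklore] -/
theorem prob_true (p : ℝ) : prob p (fun _ : ι → Bool => True) = 1 := by
  have h := prob_comp_onSet (ι := ι) p (fun _ => True)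
  simp only [filter_true_of_mem (fun _ _ => trivial), sum_biasedWeight] at h
  exact h

/-- Additivity over a case split: `Pr[P] = Pr[P ∧ Q] + Pr[P ∧ ¬Q]`. [folklore] -/
theorem prob_eq_add_prob_and_not (p : ℝ) (P Q : (ι → Bool) → Prop) :
    prob p P = prob p (fun x => P x ∧ Q x) + prob p (fun x => P x ∧ ¬ Q x) := by
  classical
  rw [prob_eq, prob_eq, prob_eq, ← filter_filter, ← filter_filter,
    sum_filter_add_sum_filter_not]

/-- Complements: `Pr[¬P] = 1 - Pr[P]`. [folklore] -/
theorem prob_not (p : ℝ) (P : (ι → Bool) → Prop) : prob p (fun x => ¬ P x) = 1 - prob p P := by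
  have h := prob_eq_add_prob_and_not p (fun _ : ι → Bool => True) P
  rw [prob_true] at h
  have e1 : prob p (fun x => True ∧ P x) = prob p P := prob_congr fun x => by simp
  have e2 : prob p (fun x => True ∧ ¬ P x) = prob p (fun x => ¬ P x) := prob_congr fun x => by simp
  rw [e1, e2] at h
  linarith

/-- `Pr[P] ≤ 1` (`p ∈ [0,1]`). [folklore] -/
theorem prob_le_one {p : ℝ} (hp0 : 0 ≤ p) (hp1 : p ≤ 1) (P : (ι → Bool) → Prop) : prob p P ≤ 1 := by
  have h1 := prob_not p P
  have h2 := prob_nonneg hp0 hp1 (fun x => ¬ P x)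
  linarith

/-- `Pr[False] = 0`. [folklore] -/
theorem prob_false (p : ℝ) : prob p (fun _ : ι → Bool => False) = 0 := by
  classical
  rw [prob_eq]; simp

/-- **Union bound** for two events (`p ∈ [0,1]`). [folklore] -/
theorem prob_or_le {p : ℝ} (hp0 : 0 ≤ p) (hp1 : p ≤ 1) (P Q : (ι → Bool) → Prop) :
    prob p (fun x => P x ∨ Q x) ≤ prob p P + prob p Q := by
  classical
  rw [prob_eq, prob_eq, prob_eq, filter_or, ← sum_union_inter]
  have : 0 ≤ ∑ x ∈ univ.filter P ∩ univ.filter Q, pw p x := sum_nonneg fun x _ => pw_nonneg hp0 hp1 x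
  linarith

/-- **Union bound** over a finite family of events (`p ∈ [0,1]`). [folklore] -/
theorem prob_exists_le {p : ℝ} (hp0 : 0 ≤ p) (hp1 : p ≤ 1) {β : Type*} (s : Finset β)
    (P : β → (ι → Bool) → Prop) :
    prob p (fun x => ∃ b ∈ s, P b x) ≤ ∑ b ∈ s, prob p (P b) := by
  classical
  induction s using Finset.induction_on with
  | empty => simp [prob_false]
  | insert b s hb ih =>
    rw [sum_insert hb]
    calc prob p (fun x => ∃ b' ∈ insert b s, P b' x)
        = prob p (fun x => P b x ∨ ∃ b' ∈ s, P b' x) := prob_congr fun x => by simp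
      _ ≤ prob p (P b) + prob p (fun x => ∃ b' ∈ s, P b' x) := prob_or_le hp0 hp1 _ _
      _ ≤ prob p (P b) + ∑ b' ∈ s, prob p (P b') := by linarith

/-- Difference bound: `Pr[P] ≤ Pr[Q] + Pr[P ∧ ¬Q]` (`p ∈ [0,1]`). [folklore] -/
theorem prob_le_prob_add_prob_and_not {p : ℝ} (hp0 : 0 ≤ p) (hp1 : p ≤ 1)
    (P Q : (ι → Bool) → Prop) : prob p P ≤ prob p Q + prob p (fun x => P x ∧ ¬ Q x) := by
  rw [prob_eq_add_prob_and_not p P Q]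
  have := prob_mono hp0 hp1 (P := fun x => P x ∧ Q x) (Q := Q) fun x hx => hx.2
  linarith

/-! ### Marginals -/

/-- **Marginals**: `Pr[S ⊆ onSet x] = p^{|S|}`. [folklore] -/
theorem prob_subset_onSet (p : ℝ) (S : Finset ι) : prob p (fun x => S ⊆ onSet x) = p ^ #S := by
  rw [prob_comp_onSet p (fun W => S ⊆ W)]
  exact sum_biasedWeight_filter_subset p S

/-- **Marginals**: `Pr[∀ i ∈ S, x i] = p^{|S|}`. [folklore] -/
theorem prob_forall_eq_true (p : ℝ) (S : Finset ι) :
    prob p (fun x => ∀ i ∈ S, x i = true) = p ^ #S := by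
  rw [← prob_subset_onSet p S]
  exact prob_congr fun x => by simp [Finset.subset_iff]

/-- One coordinate: `Pr[x i] = p`. [folklore] -/
theorem prob_apply_eq_true (p : ℝ) (i : ι) : prob p (fun x => x i = true) = p := by
  have h := prob_forall_eq_true (ι := ι) p {i}
  simp only [mem_singleton, forall_eq, card_singleton, pow_one] at h
  exact h

/-- One coordinate: `Pr[¬ x i] = 1 - p`. [folklore] -/
theorem prob_apply_eq_false (p : ℝ) (i : ι) : prob p (fun x => x i = false) = 1 - p := by
  have h := prob_not p (fun x : ι → Bool => x i = true)
  rw [prob_apply_eq_true] at h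
  rw [← h]
  exact prob_congr fun x => by simp

end Literature.Computability.Complexity
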